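import Summits.Ventures.PercRepro.ProfileIndepCogirth
import Summits.Ventures.PercRepro.ProfileSkewCorollary

/-!
# PercRepro — FAT RANK-2 SETS, DEPENDENT RANK-u SETS, AND THE INJECTION `(B, Y) ↦ B ∪ Y` (p10, gen 2; S5 §2.5)

`proofs/SUBCLAIM-S5-p10.md` §2.5, the combinatorial core of Theorem B.  For a simple matroid, a FAT rank-`2` set
`B` (dependent, i.e. `≥ 3` collinear points) and an independent `(u−2)`-set `Y` of the contraction `M / B` give the
dependent rank-`u` set `S = B ∪ Y` whose coloops are exactly `Y` (every point of `B` lies in the closure of the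
other points of `B`; every point of `Y` is a coloop), so `S ↦ (S ∖ coloops S, coloops S)` inverts the map and
`(B, Y) ↦ S` is injective: `#fatPairs M u ≤ #depU M u`.  The rank of a contraction by an ARBITRARY set is
computed through a basis of it (`IsBasis.contract_eq_contract_delete`).

* `eRk_contract_add_encard`, `rk_contract_add_rk`, `rk_gr_contract_add_rk` — `ρ_{M/B}(X) + ρ(B) = ρ(X ∪ B)`;
* `cogirthGe'_contract'` — contraction by any set keeps the cogirth bound;
* `Simple'`, `fat2`, `depU` — simplicity, the fat rank-`2` sets, the dependent rank-`u` sets;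
* `three_le_card_of_mem_fat2`, `rk_erase_eq_two_of_mem_fat2`, `mem_clF_erase_of_mem_fat2` — fat sets in a simple matroid;
* **`coloops_union_eq`** — `coloops (B ∪ Y) = Y`;
* `fatPairs`, **`card_fatPairs_le_card_depU`**, `card_fatPairs` — the injection and the count.
-/

open scoped Matroid

namespace PercRepro.Cogirth

open Finset ThmH Skew Shadow Profile

variable {α : Type} [DecidableEq α] {M : Matroid α} [M.Finite]

/-! ### Contraction by an arbitrary set -/

omit [DecidableEq α] [M.Finite] in
/-- `ρ_{M/I}(X) + |I| = ρ(X ∪ I)` for an independent set `I` and `X ⊆ E ∖ I` (set form). -/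
theorem eRk_contract_add_encard {I X : Set α} (hI : M.Indep I) (hX : X ⊆ M.E \ I) :
    (M ／ I).eRk X + I.encard = M.eRk (X ∪ I) := by
  have hdisj : Disjoint X I := Set.disjoint_of_subset_left hX Set.disjoint_sdiff_left
  have hXIE : X ∪ I ⊆ M.E := Set.union_subset (hX.trans Set.sdiff_subset) hI.subset_ground
  obtain ⟨K, hK, hIK⟩ := hI.subset_isBasis_of_subset Set.subset_union_right hXIE
  have hK' := hK.contract_isBasis_sdiff_sdiff_of_subset hIK
  rw [Set.union_sdiff_right, hdisj.sdiff_eq_left] at hK'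
  rw [hK'.eRk_eq_encard, hK.eRk_eq_encard]
  exact Set.encard_sdiff_add_encard_of_subset hIK

/-- `ρ_{M/B}(X) + ρ(B) = ρ(X ∪ B)` for any `B ⊆ E` and `X ⊆ E ∖ B`. -/
theorem rk_contract_add_rk {B : Finset α} (hBg : B ⊆ gr M) {X : Finset α} (hX : X ⊆ gr M \ B) :
    rk (M ／ (B : Set α)) X + rk M B = rk M (X ∪ B) := by
  have hBE : (B : Set α) ⊆ M.E := by
    rw [← coe_gr]
    exact_mod_cast hBg
  obtain ⟨I, hI⟩ := M.exists_isBasis (B : Set α) hBE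
  have hXE : (X : Set α) ⊆ M.E \ (B : Set α) := by
    rw [← coe_gr, ← Finset.coe_sdiff]
    exact_mod_cast hX
  -- `(M / B).eRk X = (M / I).eRk X`
  have h1 : (M ／ (B : Set α)).eRk (X : Set α) = (M ／ I).eRk (X : Set α) := by
    rw [hI.contract_eq_contract_delete, Matroid.delete_eq_restrict, Matroid.restrict_eRk_eq]
    rw [Matroid.contract_ground]
    intro x hx
    exact ⟨⟨(hXE hx).1, fun hxI => (hXE hx).2 (hI.subset hxI)⟩, fun hxB => (hXE hx).2 hxB.1⟩
  -- `(M / I).eRk X + |I| = M.eRk (X ∪ I) = M.eRk (X ∪ B)`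
  have h2 := eRk_contract_add_encard hI.indep
    (X := (X : Set α)) (fun x hx => ⟨(hXE hx).1, fun hxI => (hXE hx).2 (hI.subset hxI)⟩)
  have h3 : M.eRk ((X : Set α) ∪ I) = M.eRk ((X ∪ B : Finset α) : Set α) := by
    rw [Finset.coe_union, ← M.eRk_union_closure_right_eq (X : Set α) I, hI.closure_eq_closure,
      M.eRk_union_closure_right_eq]
  have h4 : I.encard = M.eRk (B : Set α) := hI.encard_eq_eRk
  rw [h3, h4, ← h1, ← coe_rk, ← coe_rk, ← coe_rk] at h2
  exact_mod_cast h2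

/-- The rank of `M / B` is `ρ(E) − ρ(B)`. -/
theorem rk_gr_contract_add_rk {B : Finset α} (hBg : B ⊆ gr M) :
    rk (M ／ (B : Set α)) (gr (M ／ (B : Set α))) + rk M B = rk M (gr M) := by
  rw [gr_contract_finset, rk_contract_add_rk hBg (subset_refl _), sdiff_union_of_subset hBg]

/-- Contracting any subset of the ground set keeps the cogirth bound (spanning form). -/
theorem cogirthGe'_contract' {g : ℕ} (hg : CogirthGe' M g) {B : Finset α} (hBg : B ⊆ gr M) :
    CogirthGe' (M ／ (B : Set α)) g := by
  intro X hX hcard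
  rw [gr_contract_finset] at hX hcard ⊢
  have h1 := rk_contract_add_rk hBg hX
  have h2 := rk_gr_contract_add_rk hBg
  rw [gr_contract_finset] at h2
  have hXB : X ∪ B ⊆ gr M := union_subset (hX.trans sdiff_subset) hBg
  have h3 : rk M (X ∪ B) = rk M (gr M) := by
    apply hg (X ∪ B) hXB
    rwa [sdiff_union_eq_sdiff_sdiff]
  omega

/-! ### Simple matroids, fat rank-2 sets, dependent rank-u sets -/

/-- **Simplicity** (finset form): every subset of the ground set with at most two elements is independent. -/
def Simple' (M : Matroid α) [M.Finite] : Prop :=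
  ∀ B ⊆ gr M, B.card ≤ 2 → M.Indep (B : Set α)

open Classical in
/-- The FAT rank-`2` sets: dependent sets of rank `2`. -/
noncomputable def fat2 (M : Matroid α) [M.Finite] : Finset (Finset α) :=
  (Rq M 2).filter (fun B => ¬ M.Indep (B : Set α))

open Classical in
/-- The DEPENDENT rank-`u` sets. -/
noncomputable def depU (M : Matroid α) [M.Finite] (u : ℕ) : Finset (Finset α) :=
  (levelSet M u).filter (fun S => ¬ M.Indep (S : Set α))

omit [DecidableEq α] in
open Classical in
/-- Membership in `fat2`. -/
theorem mem_fat2 {B : Finset α} : B ∈ fat2 M ↔ B ∈ Rq M 2 ∧ ¬ M.Indep (B : Set α) := by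
  unfold fat2
  rw [mem_filter]

omit [DecidableEq α] in
open Classical in
/-- Membership in `depU`. -/
theorem mem_depU {u : ℕ} {S : Finset α} : S ∈ depU M u ↔ S ∈ levelSet M u ∧ ¬ M.Indep (S : Set α) := by
  unfold depU
  rw [mem_filter]

omit [DecidableEq α] in
/-- The rank of an independent finset is its size. -/
theorem rk_eq_card_of_indep {I : Finset α} (hI : M.Indep (I : Set α)) : rk M I = I.card := by
  have h := hI.eRk_eq_encard
  rw [Set.encard_coe_eq_coe_finsetCard, ← coe_rk] at h
  exact_mod_cast h

omit [DecidableEq α] in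
/-- A finset of rank `q` in `Rq`, as a natural-number rank. -/
theorem rk_eq_of_mem_Rq {q : ℕ} {B : Finset α} (hB : B ∈ Rq M q) : rk M B = q := by
  have h := (mem_Rq.1 hB).2
  rw [← coe_rk] at h
  exact_mod_cast h

omit [DecidableEq α] in
/-- A member of `levelSet M u` has natural-number rank `u`. -/
theorem rk_eq_of_mem_levelSet {u : ℕ} {S : Finset α} (hS : S ∈ levelSet M u) : rk M S = u := by
  have h := (mem_levelSet.1 hS).2
  rw [← coe_rk] at h
  exact_mod_cast h

omit [DecidableEq α] in
/-- A subset of the ground set of natural-number rank `u` lies in `levelSet M u`. -/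
theorem mem_levelSet_of_rk {u : ℕ} {S : Finset α} (hS : S ⊆ gr M) (h : rk M S = u) : S ∈ levelSet M u := by
  rw [mem_levelSet]
  refine ⟨hS, ?_⟩
  rw [← coe_rk, h]

omit [DecidableEq α] in
/-- A fat rank-`2` set of a simple matroid has at least three elements. -/
theorem three_le_card_of_mem_fat2 (hs : Simple' M) {B : Finset α} (hB : B ∈ fat2 M) : 3 ≤ B.card := by
  rw [mem_fat2] at hB
  by_contra h
  exact hB.2 (hs B (mem_Rq.1 hB.1).1 (by omega))

/-- In a simple matroid, two distinct elements of a rank-`2` set `B` span it: removing one element of a fat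
rank-`2` set keeps the rank `2`. -/
theorem rk_erase_eq_two_of_mem_fat2 (hs : Simple' M) {B : Finset α} (hB : B ∈ fat2 M) {z : α} (hz : z ∈ B) :
    rk M (B.erase z) = 2 := by
  have h3 := three_le_card_of_mem_fat2 hs hB
  have hBg : B ⊆ gr M := (mem_Rq.1 (mem_fat2.1 hB).1).1
  have hrkB : rk M B = 2 := rk_eq_of_mem_Rq (mem_fat2.1 hB).1
  have hcard : 2 ≤ (B.erase z).card := by
    rw [card_erase_of_mem hz]
    omega
  obtain ⟨J, hJ, hJc⟩ := exists_subset_card_eq hcard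
  have hJi : M.Indep (J : Set α) := hs J ((hJ.trans (erase_subset z B)).trans hBg) (by omega)
  have hle : rk M (B.erase z) ≤ 2 := by
    rw [← hrkB]
    exact rk_mono' (erase_subset z B)
  have hge : 2 ≤ rk M (B.erase z) := by
    have := rk_mono' (M := M) hJ
    rw [rk_eq_card_of_indep hJi, hJc] at this
    exact this
  omega

/-- In a simple matroid, every element of a fat rank-`2` set lies in the closure of the others. -/
theorem mem_clF_erase_of_mem_fat2 (hs : Simple' M) {B : Finset α} (hB : B ∈ fat2 M) {z : α} (hz : z ∈ B) :
    z ∈ clF M (B.erase z) := by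
  have hBg : B ⊆ gr M := (mem_Rq.1 (mem_fat2.1 hB).1).1
  have hrkB : rk M B = 2 := rk_eq_of_mem_Rq (mem_fat2.1 hB).1
  have h := rk_insert_eq (M := M) (hBg hz) ((erase_subset z B).trans hBg)
  rw [insert_erase hz, hrkB, rk_erase_eq_two_of_mem_fat2 hs hB hz] at h
  by_contra hcl
  rw [if_neg hcl] at h
  omega

/-! ### The injection `(B, Y) ↦ B ∪ Y` -/

section Injection

variable {u : ℕ}

/-- For a fat `B` of a simple matroid and an independent `(u−2)`-set `Y` of `M / B`, the set `B ∪ Y` has rank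
`u`, is dependent, and its coloops are exactly `Y`. -/
theorem coloops_union_eq (hs : Simple' M) (hu : 2 ≤ u) {B : Finset α} (hB : B ∈ fat2 M) {Y : Finset α}
    (hY : Y ∈ indepSets (M ／ (B : Set α)) (u - 2)) :
    B ∪ Y ∈ depU M u ∧ coloops M (B ∪ Y) = Y := by
  have hBg : B ⊆ gr M := (mem_Rq.1 (mem_fat2.1 hB).1).1
  have hrkB : rk M B = 2 := rk_eq_of_mem_Rq (mem_fat2.1 hB).1
  rw [mem_indepSets, gr_contract_finset] at hY
  obtain ⟨hYg, hYc, hYi⟩ := hY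
  have hYB : Disjoint Y B := disjoint_of_subset_left hYg sdiff_disjoint
  have hSg : B ∪ Y ⊆ gr M := union_subset hBg (hYg.trans sdiff_subset)
  -- rank of `B ∪ Y` is `u`
  have hrkY : rk (M ／ (B : Set α)) Y = u - 2 := by
    rw [rk_eq_card_of_indep hYi, hYc]
  have hrkS : rk M (B ∪ Y) = u := by
    have h := rk_contract_add_rk hBg hYg
    rw [hrkY, hrkB, union_comm] at h
    omega
  -- the rank of `B ∪ Y'` for `Y' ⊆ Y`
  have hrk_sub : ∀ Y' ⊆ Y, rk M (B ∪ Y') = 2 + Y'.card := by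
    intro Y' hY'
    have hY'i : (M ／ (B : Set α)).Indep (Y' : Set α) := hYi.subset (by exact_mod_cast hY')
    have h := rk_contract_add_rk hBg (hY'.trans hYg)
    rw [rk_eq_card_of_indep hY'i, hrkB, union_comm] at h
    omega
  refine ⟨?_, ?_⟩
  · rw [mem_depU]
    refine ⟨mem_levelSet_of_rk hSg hrkS, fun hind => (mem_fat2.1 hB).2 (hind.subset ?_)⟩
    rw [Finset.coe_union]
    exact Set.subset_union_left
  · ext z
    rw [mem_coloops]
    constructor
    · rintro ⟨hzS, hzcl⟩
      rw [mem_union] at hzS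
      rcases hzS with hzB | hzY
      · -- an element of `B` is not a coloop of `B ∪ Y`
        exfalso
        apply hzcl
        have hsub : B.erase z ⊆ (B ∪ Y).erase z := erase_subset_erase z subset_union_left
        have hz' := mem_clF_erase_of_mem_fat2 hs hB hzB
        rw [← Finset.mem_coe, coe_clF] at hz' ⊢
        exact M.closure_subset_closure (by exact_mod_cast hsub) hz'
      · exact hzY
    · intro hzY
      have hzS : z ∈ B ∪ Y := mem_union_right _ hzY
      refine ⟨hzS, fun hzcl => ?_⟩
      -- `rk ((B ∪ Y).erase z) = u − 1`, so `z ∉ cl((B ∪ Y).erase z)`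
      have hzB : z ∉ B := fun h => disjoint_left.1 hYB hzY h
      have herase : (B ∪ Y).erase z = B ∪ Y.erase z := by
        ext x
        simp only [mem_erase, mem_union]
        constructor
        · rintro ⟨hxz, hx | hx⟩
          · exact Or.inl hx
          · exact Or.inr ⟨hxz, hx⟩
        · rintro (hx | ⟨hxz, hx⟩)
          · exact ⟨fun hxz => hzB (hxz ▸ hx), Or.inl hx⟩
          · exact ⟨hxz, Or.inr hx⟩
      have hYpos : 0 < Y.card := card_pos.2 ⟨z, hzY⟩
      have hrk1 : rk M ((B ∪ Y).erase z) = 2 + (Y.card - 1) := by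
        rw [herase, hrk_sub _ (erase_subset z Y), card_erase_of_mem hzY]
      have h := rk_insert_eq (M := M) (hSg hzS) ((erase_subset z _).trans hSg)
      rw [insert_erase hzS, hrkS, if_pos hzcl, hrk1] at h
      omega

/-- The pairs `(B, Y)`: a fat `B` together with an independent `(u−2)`-set of `M / B`. -/
noncomputable def fatPairs (M : Matroid α) [M.Finite] (u : ℕ) : Finset (Σ _ : Finset α, Finset α) :=
  (fat2 M).sigma (fun B => indepSets (M ／ (B : Set α)) (u - 2))

/-- `(B, Y) ↦ B ∪ Y` injects the pairs into the dependent rank-`u` sets. -/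
theorem card_fatPairs_le_card_depU (hs : Simple' M) (hu : 2 ≤ u) :
    (fatPairs M u).card ≤ (depU M u).card := by
  apply card_le_card_of_injOn (fun p : Σ _ : Finset α, Finset α => p.1 ∪ p.2)
  · intro p hp
    rw [Finset.mem_coe, fatPairs, mem_sigma] at hp
    exact Finset.mem_coe.2 (coloops_union_eq hs hu hp.1 hp.2).1
  · intro p hp p' hp' hpp'
    rw [Finset.mem_coe, fatPairs, mem_sigma] at hp hp'
    have h1 := (coloops_union_eq hs hu hp.1 hp.2).2
    have h2 := (coloops_union_eq hs hu hp'.1 hp'.2).2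
    simp only at hpp'
    have hY : p.2 = p'.2 := by rw [← h1, ← h2, hpp']
    have hB : p.1 = p'.1 := by
      have d1 : Disjoint p.1 p.2 :=
        (disjoint_of_subset_left (mem_indepSets.1 hp.2).1 (by rw [gr_contract_finset]; exact sdiff_disjoint)).symm
      have d2 : Disjoint p'.1 p'.2 :=
        (disjoint_of_subset_left (mem_indepSets.1 hp'.2).1 (by rw [gr_contract_finset]; exact sdiff_disjoint)).symm
      have e1 : p.1 = (p.1 ∪ p.2) \ p.2 := (union_sdiff_cancel_right d1).symm
      have e2 : p'.1 = (p'.1 ∪ p'.2) \ p'.2 := (union_sdiff_cancel_right d2).symm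
      rw [e1, e2, hpp', hY]
    exact Sigma.ext hB (heq_of_eq hY)

omit [DecidableEq α] in
/-- The number of pairs is `Σ_{B fat} I_{u−2}(M / B)`. -/
theorem card_fatPairs (u : ℕ) :
    (fatPairs M u).card = ∑ B ∈ fat2 M, (indepSets (M ／ (B : Set α)) (u - 2)).card := by
  unfold fatPairs
  exact card_sigma _ _

end Injection


end PercRepro.Cogirth
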